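import Mathlib
import HarnessLib

/-!
# Evaluation of rational functions at a specialisation (`stub_evalRationalFunctions`; crux
`SemivaluationShadows`, line `birth`)

Registered sub-goal `stub_evalRationalFunctions` of the crux `stmt-ResolutionOfSingularities-16757`
(`Theses.AbhyankarShadows.SemivaluationShadows`, the EXISTENCE half of Teissier's semivaluation
conjecture typed over finite sets), line `birth`: the SPECIALISATION MAP. The crux is proved for
the plane `K = K₀(y)` (`K₀ = k(t)`, `y` transcendental over `K₀`) by specialising `y` to an
algebraic approximant `ρ` (chosen by `exists_minimal_exact_specialisation`); the shadow map is
"evaluate every element of the model `R₁ ⊆ K₀[y, Pᵢ(y)/Qᵢ(y)]` at `y := ρ`", which makes sense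
because the denominators `Qᵢ` keep a non-zero value at `ρ`. This file is exactly that evaluation
map, abstractly.

Setting: fields `K₀ → K` and `K₀ → M`, an element `y : K` transcendental over `K₀`, a point
`ρ : M`, and finitely many fractions `Pᵢ(y) / Qᵢ(y)` (`Pᵢ, Qᵢ ∈ K₀[X]`, `i < n`) whose
denominators do not vanish at `ρ` (`Qᵢ(ρ) ≠ 0`). CLAIM (`evalRationalFunctions`): on the
`K₀`-subalgebra `D ⊆ K` generated by `y` and these fractions there is a `K₀`-algebra map
`φ : D → M` with `φ y = ρ`, and `φ z = A(ρ) / B(ρ)` for every representation `z · B(y) = A(y)`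
with `B(ρ) ≠ 0` (so `φ` IS evaluation at `y := ρ`, however an element is written).

Proof (`exists_subalgebra_evalAt`). Let `q = ∏ Qᵢ`; then `q(ρ) ≠ 0`, so `q ≠ 0` and, `y` being
transcendental (`Polynomial.aeval y` injective, `transcendental_iff_injective`), `q(y) ≠ 0`. The
evaluation maps `K₀[X] → M` at `ρ` and `K₀[X] → K` at `y` invert the powers of `q`, hence extend
to `K₀`-algebra maps `ψρ : K₀[X][1/q] → M` and `ψy : K₀[X][1/q] → K` on the localisation
`Localization.Away q` (`IsLocalization.liftAlgHom`); `ψy` is injective (localisation of the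
injective `aeval y` on the domain `K₀[X]`, `IsLocalization.lift_injective_iff`), so
`φ' := ψρ ∘ ψy⁻¹` is a `K₀`-algebra map on the range `D' = K₀[y][1/q(y)]` of `ψy`
(`AlgEquiv.ofInjective`). If `z ∈ D'` and `z · B(y) = A(y)` then, with `w = ψy⁻¹ z`,
`ψy (w · B) = ψy A`, so `w · B = A` in `K₀[X][1/q]` (injectivity) and `φ' z · B(ρ) = A(ρ)`.
Finally `D ≤ D'` (`y ∈ D'`, `Pᵢ(y) ∈ K₀[y] ⊆ D'`, `1/Qᵢ(y) = (q/Qᵢ)(y) · (1/q(y)) ∈ D'`),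
`φ := φ'|_D`, and `φ y = X(ρ)/1(ρ) = ρ`.

No named facts are used (localisation bookkeeping only). [folklore]
-/

noncomputable section

-- single-problem summit: the doubled namespace component `ResolutionOfSingularities` is forced
set_option linter.dupNamespace false

namespace Summit.ResolutionOfSingularities.ResolutionOfSingularities.Theorems

open Polynomial

/-- **Specialising `K₀[y][1/q(y)]` at `y := ρ`.** For `y` transcendental over `K₀` and
`q ∈ K₀[X]` with `q(ρ) ≠ 0` there are a `K₀`-subalgebra `D' ∋ y, 1/q(y)` of `K` and a
`K₀`-algebra map `φ : D' → M` with `φ z = A(ρ)/B(ρ)` whenever `z · B(y) = A(y)` and `B(ρ) ≠ 0`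
(`D'` is the isomorphic image of the localisation `K₀[X][1/q]` under `aeval y`, and `φ` is
`aeval ρ` transported along it). [folklore] -/
theorem exists_subalgebra_evalAt {K₀ K M : Type*} [Field K₀] [Field K] [Field M] [Algebra K₀ K]
    [Algebra K₀ M] {y : K} (hy : Transcendental K₀ y) (ρ : M) (q : K₀[X])
    (hqρ : aeval ρ q ≠ 0) :
    ∃ (D' : Subalgebra K₀ K) (φ : D' →ₐ[K₀] M), y ∈ D' ∧ (aeval y q)⁻¹ ∈ D' ∧
      ∀ (z : D') (A B : K₀[X]), aeval ρ B ≠ 0 → (z : K) * aeval y B = aeval y A →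
        φ z = aeval ρ A / aeval ρ B := by
  classical
  have hinj : Function.Injective (aeval y : K₀[X] →ₐ[K₀] K) := transcendental_iff_injective.mp hy
  have hq0 : q ≠ 0 := by
    rintro rfl
    exact hqρ (map_zero _)
  have hqy : aeval y q ≠ 0 := (map_ne_zero_iff _ hinj).mpr hq0
  -- the evaluations at `ρ` and at `y` invert the powers of `q`
  have huρ : ∀ s : Submonoid.powers q, IsUnit (aeval ρ (s : K₀[X])) := by
    rintro ⟨s, m, rfl⟩
    rw [map_pow]
    exact (isUnit_iff_ne_zero.mpr hqρ).pow m
  have huy : ∀ s : Submonoid.powers q, IsUnit (aeval y (s : K₀[X])) := by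
    rintro ⟨s, m, rfl⟩
    rw [map_pow]
    exact (isUnit_iff_ne_zero.mpr hqy).pow m
  -- `ψρ : K₀[X][1/q] → M` and `ψy : K₀[X][1/q] → K`
  let ψρ : Localization.Away q →ₐ[K₀] M :=
    IsLocalization.liftAlgHom (M := Submonoid.powers q) (f := aeval ρ) huρ
  let ψy : Localization.Away q →ₐ[K₀] K :=
    IsLocalization.liftAlgHom (M := Submonoid.powers q) (f := aeval y) huy
  have hψρ_alg : ∀ A : K₀[X], ψρ (algebraMap K₀[X] (Localization.Away q) A) = aeval ρ A :=
    fun A => IsLocalization.lift_eq (M := Submonoid.powers q) huρ A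
  have hψy_alg : ∀ A : K₀[X], ψy (algebraMap K₀[X] (Localization.Away q) A) = aeval y A :=
    fun A => IsLocalization.lift_eq (M := Submonoid.powers q) huy A
  -- `ψy` is injective: `K₀[X] → K₀[X][1/q]` is injective (`q ≠ 0` in a domain), so is `aeval y`
  have hψy : Function.Injective ψy :=
    (IsLocalization.lift_injective_iff (S := Localization.Away q) huy).mpr fun a b =>
      ⟨fun h => congrArg _ (IsLocalization.injective (Localization.Away q)
          (powers_le_nonZeroDivisors_of_noZeroDivisors hq0) h),
        fun h => congrArg _ (hinj h)⟩
  -- `D' := ψy (K₀[X][1/q]) ≅ K₀[X][1/q]`, `φ := ψρ ∘ ψy⁻¹`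
  let e : Localization.Away q ≃ₐ[K₀] ψy.range := AlgEquiv.ofInjective ψy hψy
  have he : ∀ u : ψy.range, ψy (e.symm u) = u := fun u => by
    rw [← AlgEquiv.ofInjective_apply ψy hψy (e.symm u), AlgEquiv.apply_symm_apply]
  let φ : ψy.range →ₐ[K₀] M := ψρ.comp (e.symm : ψy.range →ₐ[K₀] Localization.Away q)
  refine ⟨ψy.range, φ, (AlgHom.mem_range ψy).mpr ⟨algebraMap K₀[X] _ X, by rw [hψy_alg, aeval_X]⟩,
    ?_, ?_⟩
  · -- `1/q(y) = ψy (1/q)`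
    obtain ⟨u, hu⟩ : IsUnit (algebraMap K₀[X] (Localization.Away q) q) :=
      IsLocalization.map_units (Localization.Away q) ⟨q, Submonoid.mem_powers q⟩
    refine (AlgHom.mem_range ψy).mpr ⟨↑u⁻¹, eq_inv_of_mul_eq_one_left ?_⟩
    rw [← hψy_alg q, ← hu, ← map_mul, Units.inv_mul, map_one]
  · -- the evaluation formula
    intro z A B hB hz
    rw [eq_div_iff hB]
    have h1 : (e.symm z : Localization.Away q) * algebraMap K₀[X] (Localization.Away q) B =
        algebraMap K₀[X] (Localization.Away q) A := by
      apply hψy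
      rw [map_mul, he, hψy_alg, hψy_alg]
      exact hz
    have h2 := congrArg ψρ h1
    rw [map_mul, hψρ_alg, hψρ_alg] at h2
    exact h2

/-- **Evaluation of rational functions at `ρ`** (binder form of the registered sub-goal
`stub_evalRationalFunctions`). For `y : K` transcendental over `K₀`, `ρ : M`, and fractions
`Pᵢ(y)/Qᵢ(y)` with `Qᵢ(ρ) ≠ 0`: on `D = K₀[y, Pᵢ(y)/Qᵢ(y)] ⊆ K` there is a `K₀`-algebra map
`φ : D → M` with `φ y = ρ` and `φ z = A(ρ)/B(ρ)` whenever `z · B(y) = A(y)`, `B(ρ) ≠ 0`.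
[folklore] -/
theorem evalRationalFunctions (K₀ K M : Type*) [Field K₀] [Field K] [Field M] [Algebra K₀ K]
    [Algebra K₀ M] (y : K) (hy : Transcendental K₀ y) (ρ : M) (n : ℕ) (P Q : Fin n → K₀[X])
    (hQ : ∀ i, aeval ρ (Q i) ≠ 0) :
    ∃ φ : Algebra.adjoin K₀ (insert y (Set.range fun i => aeval y (P i) / aeval y (Q i)))
        →ₐ[K₀] M,
      φ ⟨y, Algebra.subset_adjoin (Set.mem_insert _ _)⟩ = ρ ∧
      ∀ (z : Algebra.adjoin K₀ (insert y (Set.range fun i => aeval y (P i) / aeval y (Q i))))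
        (A B : K₀[X]), aeval ρ B ≠ 0 → (z : K) * aeval y B = aeval y A →
        φ z = aeval ρ A / aeval ρ B := by
  classical
  have hinj : Function.Injective (aeval y : K₀[X] →ₐ[K₀] K) := transcendental_iff_injective.mp hy
  -- the common denominator `q = ∏ Qᵢ` vanishes neither at `ρ` nor at `y`
  have hqρ : aeval ρ (∏ i, Q i) ≠ 0 := by
    rw [map_prod]
    exact Finset.prod_ne_zero_iff.mpr fun i _ => hQ i
  have hqy : aeval y (∏ i, Q i) ≠ 0 := by
    rw [map_prod]
    exact Finset.prod_ne_zero_iff.mpr fun i _ =>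
      (map_ne_zero_iff _ hinj).mpr fun h => hQ i (by rw [h, map_zero])
  obtain ⟨D', φ', hyD', hqD', hφ'⟩ := exists_subalgebra_evalAt hy ρ (∏ i, Q i) hqρ
  -- `D ≤ D' = K₀[y][1/q(y)]`
  have hpoly : ∀ A : K₀[X], aeval y A ∈ D' := fun A =>
    Algebra.adjoin_le (Set.singleton_subset_iff.mpr hyD') (aeval_mem_adjoin_singleton K₀ y)
  have hle : Algebra.adjoin K₀ (insert y (Set.range fun i => aeval y (P i) / aeval y (Q i)))
      ≤ D' := by
    refine Algebra.adjoin_le ?_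
    rintro x (rfl | ⟨i, rfl⟩)
    · exact hyD'
    · -- `1/Qᵢ(y) = c(y) · (1/q(y))` where `q = Qᵢ · c`
      obtain ⟨c, hc⟩ : Q i ∣ ∏ j, Q j := Finset.dvd_prod_of_mem Q (Finset.mem_univ i)
      have hQiy : aeval y (Q i) ≠ 0 := fun h => hqy (by rw [hc, map_mul, h, zero_mul])
      have hinv : (aeval y (Q i))⁻¹ = aeval y c * (aeval y (∏ j, Q j))⁻¹ := by
        rw [eq_mul_inv_iff_mul_eq₀ hqy, hc, map_mul, inv_mul_cancel_left₀ hQiy]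
      change aeval y (P i) / aeval y (Q i) ∈ D'
      rw [div_eq_mul_inv, hinv]
      exact D'.mul_mem (hpoly _) (D'.mul_mem (hpoly _) hqD')
  refine ⟨φ'.comp (Subalgebra.inclusion hle), ?_, fun z A B hB hz => hφ' ⟨z, hle z.2⟩ A B hB hz⟩
  -- `φ y = X(ρ) / 1(ρ) = ρ`
  have h := hφ' ⟨y, hyD'⟩ X 1 (by rw [map_one]; exact one_ne_zero)
    (by rw [map_one, mul_one, aeval_X])
  rw [map_one, div_one, aeval_X] at h
  exact h

/-- **Registered sub-goal `stub_evalRationalFunctions` of line `birth` for the crux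
`SemivaluationShadows`** (the registered signature verbatim, fully quantified; it is
`evalRationalFunctions`). [folklore] -/
theorem stub_evalRationalFunctions : ∀ (K₀ K M : Type) [Field K₀] [Field K] [Field M] [Algebra K₀ K] [Algebra K₀ M] (y : K), Transcendental K₀ y → ∀ (ρ : M) (n : ℕ) (P Q : Fin n → Polynomial K₀), (∀ i, Polynomial.aeval ρ (Q i) ≠ 0) → ∃ φ : Algebra.adjoin K₀ (insert y (Set.range fun i => Polynomial.aeval y (P i) / Polynomial.aeval y (Q i))) →ₐ[K₀] M, φ ⟨y, Algebra.subset_adjoin (Set.mem_insert _ _)⟩ = ρ ∧ ∀ (z : Algebra.adjoin K₀ (insert y (Set.range fun i => Polynomial.aeval y (P i) / Polynomial.aeval y (Q i)))) (A B : Polynomial K₀), Polynomial.aeval ρ B ≠ 0 → (z : K) * Polynomial.aeval y B = Polynomial.aeval y A → φ z = Polynomial.aeval ρ A / Polynomial.aeval ρ B :=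
  fun K₀ K M _ _ _ _ _ y hy ρ n P Q hQ => evalRationalFunctions K₀ K M y hy ρ n P Q hQ

end Summit.ResolutionOfSingularities.ResolutionOfSingularities.Theorems

end
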